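import Summits.QuantumFields.YangMills.Theorems.ConvexGribovBodyCovarianceBoundDefsB
import Literature.MathematicalPhysics.QuantumLattice.RepLieAlgebraUnitary

/-!
# Helper toward `stub_zeroFreeWindowPerp` (crux stmt-QuantumFields-8780, line `Sketch`): the `𝔤^⊥`-part
# vanishes when the skew part of every represented group element lies in `𝔤`

If `½(ρ(g) − ρ(g)ᴴ) ∈ 𝔤 = r.lieAlg` for every `g : G` (e.g. `SU(2)` fundamental, where `½(W − Wᴴ)` is
traceless skew-Hermitian, or `SO(3)` in its defining representation), then every gauge-fixed gluon
`A_j(y)` lies in `𝔤`, so does the mid-link cosine mode `Ĉ_j(p)` (a real combination), hence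
`P_𝔤 Ĉ_j(p) = Ĉ_j(p)`, the `𝔤^⊥`-remainder `perpCosMode` is `0`, and `supPerpCosSq ≡ 0`: the first
disjunct of `ZeroFreeWindowPerp` holds for such `(G, r)` at every `β, S, p, j`.
-/

set_option autoImplicit false

noncomputable section

namespace Summit.QuantumFields.YangMills.Cruxes.CovarianceBound.SupportWindow

open scoped BigOperators Matrix ComplexConjugate
open Literature.MathematicalPhysics.QuantumFieldTheory

variable {G : Type} [Group G] [TopologicalSpace G]

namespace PerpVanish

/-- The gluon field lies in `𝔤` when every `½(ρ g − (ρ g)ᴴ)` does. -/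
theorem gluon_mem_lieAlg (r : LatticeRep G)
    (hskew : ∀ g : G, (1 / 2 : ℂ) • (r.ρ g - (r.ρ g)ᴴ) ∈ r.lieAlg)
    (S : ℕ) (U : GaugeConfig 4 (2 * S + 1) G) (h : Site 4 (2 * S + 1) → G)
    (y : Fin 3 → ZMod (2 * S + 1)) (j : Fin 3) :
    gluon r S U h y j ∈ r.lieAlg :=
  hskew _

/-- The mid-link cosine mode lies in `𝔤` when every `½(ρ g − (ρ g)ᴴ)` does (real combination). -/
theorem cosMode_mem_lieAlg (r : LatticeRep G)
    (hskew : ∀ g : G, (1 / 2 : ℂ) • (r.ρ g - (r.ρ g)ᴴ) ∈ r.lieAlg)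
    (S : ℕ) (p : Fin 3 → ZMod (2 * S + 1)) (j : Fin 3) (U : GaugeConfig 4 (2 * S + 1) G)
    (h : Site 4 (2 * S + 1) → G) :
    cosMode r S p j U h ∈ r.lieAlg := by
  unfold cosMode
  refine Submodule.sum_mem _ fun y _ => ?_
  rw [Complex.coe_smul]
  exact Submodule.smul_mem _ _ (gluon_mem_lieAlg r hskew S U h y j)

/-- Under the same hypothesis the `𝔤^⊥`-part of the cosine mode vanishes. -/
theorem perpCosMode_eq_zero (r : LatticeRep G)
    (hskew : ∀ g : G, (1 / 2 : ℂ) • (r.ρ g - (r.ρ g)ᴴ) ∈ r.lieAlg)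
    (S : ℕ) (p : Fin 3 → ZMod (2 * S + 1)) (j : Fin 3) (U : GaugeConfig 4 (2 * S + 1) G)
    (h : Site 4 (2 * S + 1) → G) :
    perpCosMode r S p j U h = 0 := by
  unfold perpCosMode
  rw [r.lieProj_of_mem (cosMode_mem_lieAlg r hskew S p j U h), sub_self]

/-- `froSq 0 = 0`. -/
theorem froSq_zero {N : ℕ} : froSq (0 : Matrix (Fin N) (Fin N) ℂ) = 0 := by
  simp [froSq]

end PerpVanish

open PerpVanish in
/-- **Helper stub `supPerpCosSq_eq_zero_of_skew_mem`** (toward `stub_zeroFreeWindowPerp`, first disjunct):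
if `½(ρ(g) − ρ(g)ᴴ) ∈ 𝔤` for every `g`, then `sup_{argmin} ‖Ĉ_j(p) − P_𝔤 Ĉ_j(p)‖²_F = 0` for every
configuration, momentum and polarisation. -/
theorem supPerpCosSq_eq_zero_of_skew_mem :
    ∀ (G : Type) [Group G] [TopologicalSpace G] (r : LatticeRep G),
      (∀ g : G, (1 / 2 : ℂ) • (r.ρ g - (r.ρ g)ᴴ) ∈ r.lieAlg) →
      ∀ (S : ℕ) (p : Fin 3 → ZMod (2 * S + 1)) (j : Fin 3) (U : GaugeConfig 4 (2 * S + 1) G),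
        supPerpCosSq r S p j U = 0 := by
  intro G _ _ r hskew S p j U
  unfold supPerpCosSq
  simp only [perpCosMode_eq_zero r hskew, froSq_zero]
  exact Real.iSup_const_zero

/-! ### The hypothesis holds for the fundamental representation of `SU(2)` -/

namespace PerpVanish

open Literature.MathematicalPhysics.QuantumLattice in
/-- For `V ∈ SU(2)`, `V₁₁ = conj V₀₀` (`V⁻¹ = Vᴴ` and `V⁻¹ = adj V`). -/
theorem su2_apply_one_one (V : Matrix.specialUnitaryGroup (Fin 2) ℂ) :
    (V : Matrix (Fin 2) (Fin 2) ℂ) 1 1 = star ((V : Matrix (Fin 2) (Fin 2) ℂ) 0 0) := by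
  obtain ⟨hU, hdet⟩ := Matrix.mem_specialUnitaryGroup_iff.1 V.2
  have h1 : star (V : Matrix (Fin 2) (Fin 2) ℂ) * V = 1 := Matrix.mem_unitaryGroup_iff'.1 hU
  have hinv : (V : Matrix (Fin 2) (Fin 2) ℂ)⁻¹ = star (V : Matrix (Fin 2) (Fin 2) ℂ) :=
    Matrix.inv_eq_left_inv h1
  have hadj : (V : Matrix (Fin 2) (Fin 2) ℂ)⁻¹ = (V : Matrix (Fin 2) (Fin 2) ℂ).adjugate := by
    rw [Matrix.inv_def, hdet, Ring.inverse_one, one_smul]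
  have h := congrFun (congrFun (hinv.symm.trans hadj) 0) 0
  rw [Matrix.star_apply, Matrix.adjugate_fin_two] at h
  simpa using h.symm

/-- The trace of `V ∈ SU(2)` is real. -/
theorem su2_trace_im (V : Matrix.specialUnitaryGroup (Fin 2) ℂ) :
    ((V : Matrix (Fin 2) (Fin 2) ℂ)).trace.im = 0 := by
  rw [Matrix.trace_fin_two, su2_apply_one_one]
  simp

open Literature.MathematicalPhysics.QuantumLattice in
/-- **`SU(2)` fundamental: `½(V − Vᴴ) ∈ 𝔤`** — it is skew-Hermitian and traceless, hence generates a
one-parameter subgroup of `SU(2) = range ρ`. -/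
theorem skew_mem_lieAlg_fundamental_two (g : Matrix.specialUnitaryGroup (Fin 2) ℂ) :
    (1 / 2 : ℂ) • ((fundamentalLatticeRep 2).ρ g - ((fundamentalLatticeRep 2).ρ g)ᴴ) ∈
      (fundamentalLatticeRep 2).lieAlg := by
  refine (fundamentalLatticeRep 2).lieAlgCarrier_subset_lieAlg ?_
  set V : Matrix (Fin 2) (Fin 2) ℂ := (fundamentalLatticeRep 2).ρ g with hV
  have hVg : V = (g : Matrix (Fin 2) (Fin 2) ℂ) := rfl
  set X : Matrix (Fin 2) (Fin 2) ℂ := (1 / 2 : ℂ) • (V - Vᴴ) with hX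
  have hstar : star X = -X := by
    rw [hX, star_smul, star_sub, Matrix.star_eq_conjTranspose, Matrix.star_eq_conjTranspose,
      Matrix.conjTranspose_conjTranspose, ← smul_neg, neg_sub]
    congr 1
    simp
  have htr : X.trace = 0 := by
    have him := su2_trace_im g
    rw [← hVg] at him
    rw [hX, Matrix.trace_smul, Matrix.trace_sub, Matrix.trace_conjTranspose, smul_eq_mul]
    have hreal : star V.trace = V.trace := Complex.conj_eq_iff_im.2 him
    rw [hreal, sub_self, mul_zero]
  refine ⟨hstar, fun t => ?_⟩
  have hmem := mem_oneParamGenerators_specialUnitaryGroup hstar htr t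
  rw [range_fundamentalLatticeRep]
  exact hmem

end PerpVanish

open PerpVanish Literature.MathematicalPhysics.QuantumLattice in
/-- **`SU(2)` fundamental: the `𝔤^⊥`-part of the cosine mode vanishes at every minimiser**, so the
first disjunct of `ZeroFreeWindowPerp` holds for `(SU(2), fundamentalLatticeRep 2)` at every `S, p, j`. -/
theorem supPerpCosSq_fundamental_two_eq_zero (S : ℕ) (p : Fin 3 → ZMod (2 * S + 1)) (j : Fin 3)
    (U : GaugeConfig 4 (2 * S + 1) (Matrix.specialUnitaryGroup (Fin 2) ℂ)) :
    supPerpCosSq (fundamentalLatticeRep 2) S p j U = 0 :=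
  supPerpCosSq_eq_zero_of_skew_mem _ (fundamentalLatticeRep 2) skew_mem_lieAlg_fundamental_two S p j U

end Summit.QuantumFields.YangMills.Cruxes.CovarianceBound.SupportWindow

end
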